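import Literature.Analysis.Complex.OsgoodProofs
import Mathlib.RingTheory.MvPolynomial.Basic
import HarnessLib

/-!
# Liouville's theorem in several variables: entire functions of polynomial growth are polynomials

Layer `Literature/Analysis/Complex`. The several-variable companion of
`Literature/Analysis/Complex/PolynomialGrowthLiouville.lean` (one variable): an entire function
`f : ℂ^ι → ℂ` (`ι` finite) with `|f(z)| ≤ C (1 + |z|)^K` is (the evaluation of) a polynomial in the
coordinates of total degree `≤ K`. This is the form in which holomorphic functions of polynomial
growth on finite coverings of affine varieties are recognised as algebraic (Serre, GAGA n° 19–20;
SGA 1 XII 5.1: the elementary symmetric functions of such a function along a finite projection to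
`ℂⁿ` are entire of polynomial growth on `ℂⁿ`, hence polynomials).

Proof (Hörmander, Thm. 2.2.7, Cauchy's inequalities, with Thm. 2.2.6, the Taylor expansion): for an
entire `f` on a finite-dimensional complex normed space `E` the Taylor series at `x` converges to `f`
on all of `E` (`hasSum_taylorFPowerSeries_of_entire`, from the tree's quantitative Osgood lemma
`SCV.hasFPowerSeriesOnBall_taylorFPowerSeries`); the Cauchy estimate
`‖Dʲf(x)‖ ≤ (j/ρ)ʲ sup_{B̄(x,ρ)} |f|` (`norm_iteratedFDeriv_le_of_entire`, the tree's
`SCV.norm_iteratedFDeriv_le_of_closedBall` with `δ = ρ/j`) and the growth bound give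
`‖Dʲf(x)‖ ≤ c ρ^{K-j} → 0` (`ρ → ∞`) for `j > K`, so `Dʲ f ≡ 0` for `j > K`
(`iteratedFDeriv_eq_zero_of_growth`) and `f(y) = ∑_{j ≤ K} Dʲf(0)(y, …, y)/j!`
(`eq_sum_taylorFPowerSeries_of_growth`); finally a continuous `j`-linear form `A` on `ℂ^ι` evaluated
on the diagonal is the polynomial `∑_{r : Fin j → ι} A(e_{r 1}, …, e_{r j}) ∏_t X_{r t}` of total degree
`≤ j` (`exists_mvPolynomial_eval_eq_apply_const`), whence the theorem
`exists_mvPolynomial_of_growth` (and the variant `exists_mvPolynomial_of_growth_of_one_le_norm` with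
the bound assumed only for `|z| ≥ 1`).

Everything here is proved; no definitions, no named facts.

## References

* L. Hörmander, *An Introduction to Complex Analysis in Several Variables*, 2nd ed. (1973),
  Thm. 2.2.6 (Taylor expansion), Thm. 2.2.7 (Cauchy's inequalities). [HormanderSCV1973]
* J.-P. Serre, *Géométrie algébrique et géométrie analytique*, Ann. Inst. Fourier 6 (1956),
  n° 19–20. [SerreGAGA1956]

#harness_tags complex_analysis.several_variables, complex_geometry.riemann_existence
-/

noncomputable section

open Complex Metric Set Filter
open scoped Topology

namespace Literature.Analysis.Complex

namespace SCV

variable {E : Type*} [NormedAddCommGroup E] [NormedSpace ℂ E] [FiniteDimensional ℂ E]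
  {F : Type*} [NormedAddCommGroup F] [NormedSpace ℂ F] [CompleteSpace F]

/-! ### Entire functions: Cauchy estimates at the centre and the global Taylor expansion -/

/-- **Cauchy's inequality for an entire function** (Hörmander, Thm. 2.2.7 with `δ = ρ/j`): if
`‖f‖ ≤ M` on `closedBall x ρ`, `ρ > 0`, `j ≥ 1`, then `‖Dʲ f (x)‖ ≤ M / (ρ/j)ʲ`.
[cite: HormanderSCV1973, Thm 2.2.7] -/
theorem norm_iteratedFDeriv_le_of_entire {f : E → F} (hf : Differentiable ℂ f) {x : E} {ρ M : ℝ}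
    (hρ : 0 < ρ) (hM : ∀ z ∈ closedBall x ρ, ‖f z‖ ≤ M) {j : ℕ} (hj : 0 < j) :
    ‖iteratedFDeriv ℂ j f x‖ ≤ M / (ρ / j) ^ j := by
  have hjr : (0 : ℝ) < j := by exact_mod_cast hj
  have hjδ : (j : ℝ) * (ρ / j) ≤ ρ := by
    rw [mul_div_cancel₀ _ hjr.ne']
  refine norm_iteratedFDeriv_le_of_closedBall hf.differentiableOn isOpen_univ (subset_univ _) hM
    (div_pos hρ hjr) j hjδ ?_
  rw [mul_div_cancel₀ _ hjr.ne', sub_self]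
  exact mem_closedBall_self le_rfl

omit [NormedSpace ℂ E] [FiniteDimensional ℂ E] [NormedSpace ℂ F] [CompleteSpace F] in
/-- A polynomial growth bound `‖f z‖ ≤ C (1 + ‖z‖)^K` bounds `f` on `closedBall x ρ` by
`C' (1 + ‖x‖ + ρ)^K` with `C' = max C 0 ≥ 0`. [folklore] -/
theorem norm_le_of_growth_of_mem_closedBall {f : E → F} {C : ℝ} {K : ℕ}
    (hgr : ∀ z, ‖f z‖ ≤ C * (1 + ‖z‖) ^ K) {x : E} {ρ : ℝ}
    {z : E} (hz : z ∈ closedBall x ρ) : ‖f z‖ ≤ max C 0 * (1 + ‖x‖ + ρ) ^ K := by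
  have hz' : ‖z‖ ≤ ‖x‖ + ρ := by
    rw [mem_closedBall, dist_eq_norm] at hz
    calc ‖z‖ = ‖(z - x) + x‖ := by rw [sub_add_cancel]
      _ ≤ ‖z - x‖ + ‖x‖ := norm_add_le _ _
      _ ≤ ρ + ‖x‖ := by gcongr
      _ = ‖x‖ + ρ := add_comm _ _
  calc ‖f z‖ ≤ C * (1 + ‖z‖) ^ K := hgr z
    _ ≤ max C 0 * (1 + ‖z‖) ^ K := mul_le_mul_of_nonneg_right (le_max_left C 0) (by positivity)
    _ ≤ max C 0 * (1 + ‖x‖ + ρ) ^ K := by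
        have h : 1 + ‖z‖ ≤ 1 + ‖x‖ + ρ := by linarith
        exact mul_le_mul_of_nonneg_left (pow_le_pow_left₀ (by positivity) h K) (le_max_right _ _)

/-- **High derivatives of an entire function of polynomial growth vanish**: if
`‖f z‖ ≤ C (1 + ‖z‖)^K` on `E` then `Dʲ f ≡ 0` for every `j > K` (Cauchy's inequality on balls of
radius `ρ → ∞`: `‖Dʲf(x)‖ ≤ C' (1 + ‖x‖ + ρ)^K jʲ / ρʲ ≤ C'' / ρ`). [cite: HormanderSCV1973, Thm 2.2.7] -/
theorem iteratedFDeriv_eq_zero_of_growth {f : E → F} (hf : Differentiable ℂ f) {C : ℝ} {K : ℕ}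
    (hgr : ∀ z, ‖f z‖ ≤ C * (1 + ‖z‖) ^ K) {j : ℕ} (hj : K < j) (x : E) :
    iteratedFDeriv ℂ j f x = 0 := by
  have hj0 : 0 < j := lt_of_le_of_lt (Nat.zero_le K) hj
  set C' : ℝ := max C 0 with hC'
  have hC'0 : 0 ≤ C' := le_max_right _ _
  -- the constant in the bound `‖Dʲ f x‖ ≤ A / ρ` for `ρ ≥ ρ₀ := 1 + ‖x‖`
  set A : ℝ := C' * 2 ^ K * (j : ℝ) ^ j with hA
  have hA0 : 0 ≤ A := by positivity
  have hbound : ∀ ρ : ℝ, 1 + ‖x‖ ≤ ρ → ‖iteratedFDeriv ℂ j f x‖ ≤ A / ρ := by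
    intro ρ hρ
    have hρ1 : 1 ≤ ρ := by linarith [norm_nonneg x]
    have hρpos : 0 < ρ := lt_of_lt_of_le one_pos hρ1
    have hM : ∀ z ∈ closedBall x ρ, ‖f z‖ ≤ C' * (2 * ρ) ^ K := by
      intro z hz
      calc ‖f z‖ ≤ C' * (1 + ‖x‖ + ρ) ^ K := norm_le_of_growth_of_mem_closedBall hgr hz
        _ ≤ C' * (2 * ρ) ^ K := by
            have h2 : 1 + ‖x‖ + ρ ≤ 2 * ρ := by linarith
            exact mul_le_mul_of_nonneg_left (pow_le_pow_left₀ (by positivity) h2 K) hC'0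
    have h1 := norm_iteratedFDeriv_le_of_entire hf hρpos hM hj0
    have hjr : (0 : ℝ) < j := by exact_mod_cast hj0
    -- `C' (2ρ)^K / (ρ/j)^j = C' 2^K j^j ρ^K / ρ^j ≤ A / ρ` as `j ≥ K + 1` and `ρ ≥ 1`
    have hcalc : C' * (2 * ρ) ^ K / (ρ / j) ^ j = A * (ρ ^ K / ρ ^ j) := by
      rw [hA, div_pow, mul_pow]
      field_simp
    rw [hcalc] at h1
    refine h1.trans ?_
    rw [div_eq_mul_inv A ρ]
    refine mul_le_mul_of_nonneg_left ?_ hA0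
    rw [div_le_iff₀ (pow_pos hρpos j), ← div_eq_inv_mul, le_div_iff₀ hρpos, ← pow_succ]
    exact pow_le_pow_right₀ hρ1 (Nat.succ_le_of_lt hj)
  -- let `ρ → ∞`
  have hlim : Tendsto (fun ρ : ℝ ↦ A / ρ) atTop (𝓝 0) := tendsto_const_nhds.div_atTop tendsto_id
  have hle : ‖iteratedFDeriv ℂ j f x‖ ≤ 0 :=
    ge_of_tendsto hlim (Filter.eventually_atTop.2 ⟨1 + ‖x‖, hbound⟩)
  exact norm_le_zero_iff.1 hle

/-- **The Taylor series of an entire function converges everywhere**: for `f` entire on a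
finite-dimensional complex normed space and all `x, y`,
`f (x + y) = ∑ₙ Dⁿf(x)(y, …, y)/n!`. [cite: HormanderSCV1973, Thm 2.2.6] -/
theorem hasSum_taylorFPowerSeries_of_entire {f : E → F} (hf : Differentiable ℂ f) (x y : E) :
    HasSum (fun n ↦ taylorFPowerSeries f x n fun _ ↦ y) (f (x + y)) := by
  have hρ : (0 : ℝ) < 3 * (‖y‖ + 1) := by positivity
  have hy : ‖y‖ < 3 * (‖y‖ + 1) / 3 := by linarith
  exact hasSum_taylorFPowerSeries hf.differentiableOn isOpen_univ hρ (subset_univ _) hy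

/-- **An entire function of polynomial growth is its Taylor polynomial of degree `K`**:
`f y = ∑_{n ≤ K} Dⁿf(0)(y, …, y)/n!` when `‖f z‖ ≤ C (1 + ‖z‖)^K`.
[cite: HormanderSCV1973, Thm 2.2.6 and Thm 2.2.7] -/
theorem eq_sum_taylorFPowerSeries_of_growth {f : E → F} (hf : Differentiable ℂ f) {C : ℝ} {K : ℕ}
    (hgr : ∀ z, ‖f z‖ ≤ C * (1 + ‖z‖) ^ K) (y : E) :
    f y = ∑ n ∈ Finset.range (K + 1), taylorFPowerSeries f 0 n fun _ ↦ y := by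
  have hsum := hasSum_taylorFPowerSeries_of_entire hf 0 y
  rw [zero_add] at hsum
  have hfin : ∀ n ∉ Finset.range (K + 1), (taylorFPowerSeries f 0 n fun _ ↦ y) = 0 := by
    intro n hn
    rw [Finset.mem_range, not_lt] at hn
    rw [taylorFPowerSeries_apply, iteratedFDeriv_eq_zero_of_growth hf hgr (Nat.lt_of_succ_le hn) 0]
    simp
  exact hsum.unique (hasSum_sum_of_ne_finset_zero hfin)

end SCV

/-! ### Multilinear forms on `ℂ^ι` evaluated on the diagonal are polynomials -/

section Multilinear

variable {ι : Type*} [Fintype ι] {j : ℕ}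

/-- **A `j`-linear form on `ℂ^ι` on the diagonal is a polynomial of total degree `≤ j`**: for
`A` continuous `j`-linear on `ℂ^ι = ι → ℂ`, the polynomial
`p = ∑_{r : Fin j → ι} A(e_{r 0}, …, e_{r (j-1)}) ∏_t X_{r t}` has `totalDegree p ≤ j` and
`eval z p = A (z, …, z)` (multilinear expansion of `z = ∑ᵢ zᵢ eᵢ` in each slot). [folklore] -/
theorem exists_mvPolynomial_eval_eq_apply_const
    (A : ContinuousMultilinearMap ℂ (fun _ : Fin j ↦ ι → ℂ) ℂ) :
    ∃ p : MvPolynomial ι ℂ, p.totalDegree ≤ j ∧ ∀ z : ι → ℂ, MvPolynomial.eval z p = A fun _ ↦ z := by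
  classical
  refine ⟨∑ r : Fin j → ι, MvPolynomial.C (A fun t ↦ Pi.single (r t) 1) * ∏ t, MvPolynomial.X (r t),
    ?_, fun z ↦ ?_⟩
  · -- total degree
    refine (MvPolynomial.totalDegree_finsetSum _ _).trans (Finset.sup_le fun r _ ↦ ?_)
    refine (MvPolynomial.totalDegree_mul _ _).trans ?_
    rw [MvPolynomial.totalDegree_C, zero_add]
    refine (MvPolynomial.totalDegree_finsetProd _ _).trans ?_
    calc ∑ t : Fin j, (MvPolynomial.X (R := ℂ) (r t)).totalDegree ≤ ∑ _t : Fin j, 1 :=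
          Finset.sum_le_sum fun t _ ↦ (MvPolynomial.totalDegree_X (R := ℂ) (r t)).le
      _ = j := by simp
  · -- evaluation on the diagonal
    have hz : (fun _ : Fin j ↦ z) = fun _ : Fin j ↦ ∑ i : ι, Pi.single i (z i) := by
      funext t
      exact (Finset.univ_sum_single z).symm
    rw [hz, A.map_sum (fun (_ : Fin j) (i : ι) ↦ (Pi.single i (z i) : ι → ℂ)), map_sum]
    refine Finset.sum_congr rfl fun r _ ↦ ?_
    rw [map_mul, MvPolynomial.eval_C, map_prod]
    simp only [MvPolynomial.eval_X]
    have hsingle : (fun t : Fin j ↦ (Pi.single (r t) (z (r t)) : ι → ℂ)) =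
        fun t ↦ z (r t) • (Pi.single (r t) 1 : ι → ℂ) := by
      funext t
      rw [← Pi.single_smul, smul_eq_mul, mul_one]
    rw [hsingle, A.map_smul_univ, smul_eq_mul, mul_comm]

end Multilinear

/-! ### Liouville's theorem with polynomial growth in `ℂ^ι` -/

section Liouville

variable {ι : Type*} [Fintype ι]

/-- **Liouville's theorem in several variables, polynomial growth.** An entire function
`f : ℂ^ι → ℂ` (`ι` finite, `ℂ^ι = ι → ℂ` with the sup norm) with `|f(z)| ≤ C (1 + ‖z‖)^K` for all
`z` is a polynomial in the coordinates of total degree `≤ K`: there is `p ∈ ℂ[X_i : i ∈ ι]` with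
`totalDegree p ≤ K` and `f = eval(·) p`. [cite: HormanderSCV1973, Thm 2.2.6 and Thm 2.2.7] -/
theorem exists_mvPolynomial_of_growth {f : (ι → ℂ) → ℂ} (hf : Differentiable ℂ f) {C : ℝ} {K : ℕ}
    (hgr : ∀ z, ‖f z‖ ≤ C * (1 + ‖z‖) ^ K) :
    ∃ p : MvPolynomial ι ℂ, p.totalDegree ≤ K ∧ ∀ z, MvPolynomial.eval z p = f z := by
  classical
  choose p hpdeg hpeval using
    fun n ↦ exists_mvPolynomial_eval_eq_apply_const (SCV.taylorFPowerSeries f 0 n)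
  refine ⟨∑ n ∈ Finset.range (K + 1), p n, ?_, fun z ↦ ?_⟩
  · refine (MvPolynomial.totalDegree_finsetSum _ _).trans (Finset.sup_le fun n hn ↦ ?_)
    rw [Finset.mem_range] at hn
    exact (hpdeg n).trans (Nat.le_of_lt_succ hn)
  · rw [SCV.eq_sum_taylorFPowerSeries_of_growth hf hgr z, map_sum]
    exact Finset.sum_congr rfl fun n _ ↦ hpeval n z

/-- **Liouville's theorem in several variables, polynomial growth at infinity.** If `f : ℂ^ι → ℂ`
is entire and `|f(z)| ≤ C ‖z‖^K` for `‖z‖ ≥ 1`, then `f` is a polynomial of total degree `≤ K`.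
[cite: HormanderSCV1973, Thm 2.2.6 and Thm 2.2.7] -/
theorem exists_mvPolynomial_of_growth_of_one_le_norm {f : (ι → ℂ) → ℂ} (hf : Differentiable ℂ f)
    {C : ℝ} {K : ℕ} (hgr : ∀ z, 1 ≤ ‖z‖ → ‖f z‖ ≤ C * ‖z‖ ^ K) :
    ∃ p : MvPolynomial ι ℂ, p.totalDegree ≤ K ∧ ∀ z, MvPolynomial.eval z p = f z := by
  -- a bound on the unit ball
  haveI : ProperSpace (ι → ℂ) := inferInstance
  obtain ⟨M, hM⟩ : ∃ M, ∀ z ∈ closedBall (0 : ι → ℂ) 1, ‖f z‖ ≤ M :=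
    (isCompact_closedBall 0 1).exists_bound_of_continuousOn hf.continuous.continuousOn
  refine exists_mvPolynomial_of_growth hf (C := max M 0 + max C 0) (K := K) fun z ↦ ?_
  have h1 : (1 : ℝ) ≤ (1 + ‖z‖) ^ K := one_le_pow₀ (by linarith [norm_nonneg z])
  rcases le_or_gt ‖z‖ 1 with hz | hz
  · calc ‖f z‖ ≤ M := hM z (by simpa using hz)
      _ ≤ max M 0 + max C 0 := le_max_left M 0 |>.trans (le_add_of_nonneg_right (le_max_right _ _))
      _ ≤ (max M 0 + max C 0) * (1 + ‖z‖) ^ K :=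
          le_mul_of_one_le_right (add_nonneg (le_max_right _ _) (le_max_right _ _)) h1
  · calc ‖f z‖ ≤ C * ‖z‖ ^ K := hgr z hz.le
      _ ≤ max C 0 * ‖z‖ ^ K := mul_le_mul_of_nonneg_right (le_max_left C 0) (by positivity)
      _ ≤ max C 0 * (1 + ‖z‖) ^ K :=
          mul_le_mul_of_nonneg_left
            (pow_le_pow_left₀ (norm_nonneg z) (by linarith [norm_nonneg z]) K) (le_max_right _ _)
      _ ≤ (max M 0 + max C 0) * (1 + ‖z‖) ^ K :=
          mul_le_mul_of_nonneg_right (le_add_of_nonneg_left (le_max_right _ _)) (by positivity)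

end Liouville

end Literature.Analysis.Complex
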